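import Summits.Langlands.Langlands.Theorems.PhantomRMYoshidaResiduallyYoshidaLiftingRibetNonsplitLattice
import Summits.Langlands.Langlands.Theorems.PhantomRMYoshidaResiduallyYoshidaLiftingRealisedClassSelmer
import Summits.Langlands.Langlands.Theorems.PhantomRMYoshidaResiduallyYoshidaLiftingAnchorOfSameClass
import Summits.Langlands.Langlands.Theorems.PhantomRMYoshidaResiduallyYoshidaLiftingDefs
import HarnessLib

/-!
# The anchor is DISCHARGED on Selmer-rank-one data (stub `stub_selmerAnchorRel_of_rankOne`, K2) — line `sector-klingen-split`,
# crux `ResiduallyYoshidaLifting` (stmt-Langlands-13639)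

Lead prover-line-stmt-Langlands-13639-c4-0 (continuation c4, cycle 2, skeleton rev 11, 2026-08-17).

The open anchor stub R1c-rel (`stub_selmerAnchorRel`) asks that every non-trivial residual class `[B] ∈ H¹(ℚ, Hom(σ̄′, σ̄))` realised by an
`Sh`-point be realised by an AUTOMORPHIC Klingen-shape point.  Rev 6 (c3, p148691) discharged it on CYCLIC fibres — all classes realised by
irreducible `Sh`-points projectively equal — with `ρ₁ := ρ₀`, the crux's own automorphic anchor; but that hypothesis quantified over
REALISERS.  With R1(b) complete (K3 `stub_realisedClassSelmer`, p160559: a realised class is a GREENBERG–SELMER cocycle — 1-cocycle, locally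
constant, unramified wherever the point is, Greenberg at `p`) the hypothesis becomes one on the residual pair and a finite set of places only:

**Theorem (`stub_selmerAnchorRel_of_rankOne`).**  Admissible fibre (`σ̄, σ̄′` irreducible, non-conjugate, `det σ̄ = det σ̄′ = ε̄⁻¹`), anchor
`ρ₀` (irreducible, `Sh`, `Aut`), `B` not a coboundary, realised by an `Sh`-point `ρ`; `S` a set of places outside which `ρ` and `ρ₀` are
unramified.  If the non-coboundary Greenberg–Selmer cocycles with ramification inside `S` are pairwise projectively equal modulo
coboundaries (the RANK-ONE regime of Berger–Klosin (Math. Ann. 355, 2013) §10: `dim_k H¹_Gr,S(ℚ, Hom(σ̄′, σ̄)) = 1`, in cocycle language), then the anchor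
stub's conclusion holds for `B` with `ρ₁ := ρ₀`.

Proof: Ribet R1a (p142340) gives a non-trivial class `B₀` realised by `ρ₀`; K3 makes `B₀` and `B` Greenberg–Selmer cocycles with
ramification inside `S`; rank one gives `B = c B₀ + δX`; p148691 (`stub_anchorOfSameClass`) realises `B` by `ρ₀` itself.
Refs: Berger–Klosin, *On deformation rings of residually reducible Galois representations and R = T theorems*, Math. Ann. 355 (2013) §10;
Skinner–Wiles 1999 §2.  Everything used is proved in the tree.
-/

noncomputable section

open scoped MatrixGroups Matrix

set_option linter.dupNamespace false
set_option autoImplicit false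

namespace Summit.Langlands.Langlands.Cruxes.ResiduallyYoshidaLifting.SectorKlingenSplit.Fibre

open IsDedekindDomain Filter
open Literature.NumberTheory.GaloisRepresentations Literature.NumberTheory.Automorphic
open Summit.Langlands.Langlands.Cruxes.ResiduallyYoshidaLifting.YoshidaDivisorSelmerCount

/-- **Registered statement `stub_selmerAnchorRel_of_rankOne`** (crux stmt-Langlands-13639, line `sector-klingen-split`, skeleton rev 11):
THE ANCHOR IS DISCHARGED ON SELMER-RANK-ONE DATA — see the module docstring. [cite: BergerKlosin2012, §10] -/
theorem stub_selmerAnchorRel_of_rankOne :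
    ∀ (p : ℕ) [Fact p.Prime], p ≠ 2 → ∀ (k : Type) [Field k] [CharP k p] [IsAlgClosed k]
    [TopologicalSpace k] [DiscreteTopology k] (red : Valued.integer (PadicAlgCl p) →+* k)
    (σ σ' : FramedGaloisRep ℚ k 2) (hcpt : isCompact_glFiniteIntegralLevel 4 ℚ) (ι : PadicAlgCl p ≃+* ℂ)
    (ρ₀ ρ : FramedGaloisRep ℚ (PadicAlgCl p) 4) (B : Field.absoluteGaloisGroup ℚ → Matrix (Fin 2) (Fin 2) k)
    (S : Set (HeightOneSpectrum (NumberField.RingOfIntegers ℚ))),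
    σ.toGaloisRep.IsIrreducible → σ'.toGaloisRep.IsIrreducible → DetC p k σ σ' →
    (¬ ∃ g : GL (Fin 2) k, ∀ x, g * σ x * g⁻¹ = σ' x) →
    ρ₀.toGaloisRep.IsIrreducible → Sh p k red σ σ' ρ₀ → Aut p hcpt ι ρ₀ →
    (¬ ∃ X : Matrix (Fin 2) (Fin 2) k, ∀ g, B g = (σ g).val * X - X * (σ' g).val) →
    Sh p k red σ σ' ρ →
    (∃ (P : GL (Fin 4) (PadicAlgCl p))
        (rint : Field.absoluteGaloisGroup ℚ →* GL (Fin 4) (Valued.integer (PadicAlgCl p))) (h : GL (Fin 4) k),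
        (∀ g, Matrix.GeneralLinearGroup.map (Valued.integer (PadicAlgCl p)).subtype (rint g) = P⁻¹ * ρ g * P) ∧
        (∀ g, (Matrix.GeneralLinearGroup.map red (rint g)).val =
          h.val * Matrix.reindex finSumFinEquiv finSumFinEquiv
            (Matrix.fromBlocks (σ g).val (B g) 0 (σ' g).val) * (h⁻¹).val)) →
    (∀ v ∉ S, ρ.IsUnramifiedAt v ∧ ρ₀.IsUnramifiedAt v) →
    (∀ B₁ B₂ : Field.absoluteGaloisGroup ℚ → Matrix (Fin 2) (Fin 2) k,
      (∀ g g', B₁ (g * g') = (σ g).val * B₁ g' + B₁ g * (σ' g').val) →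
      (∀ g g', B₂ (g * g') = (σ g).val * B₂ g' + B₂ g * (σ' g').val) →
      IsLocallyConstant B₁ → IsLocallyConstant B₂ →
      (∀ v ∉ S, ∀ 𝔓 ∈ v.primesAbove, ∀ i ∈ 𝔓.inertia (Field.absoluteGaloisGroup ℚ), B₁ i = 0 ∧ B₂ i = 0) →
      (∀ v : HeightOneSpectrum (NumberField.RingOfIntegers ℚ), ((p : ℕ) : NumberField.RingOfIntegers ℚ) ∈ v.asIdeal →
        (∃ (X₀ : Matrix (Fin 2) (Fin 2) k) (x₁ y₁ : Fin 2 → k), x₁ ≠ 0 ∧ y₁ ≠ 0 ∧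
          (∀ τ ∈ absInertia (v.adicCompletion ℚ),
            (σ (absGaloisRestrict ℚ (v.adicCompletion ℚ) τ)).val *ᵥ x₁ = x₁) ∧
          (∀ τ ∈ absInertia (v.adicCompletion ℚ),
            (σ' (absGaloisRestrict ℚ (v.adicCompletion ℚ) τ)).val *ᵥ y₁ = y₁) ∧
          ∀ τ ∈ absInertia (v.adicCompletion ℚ),
            (B₁ (absGaloisRestrict ℚ (v.adicCompletion ℚ) τ) -
              ((σ (absGaloisRestrict ℚ (v.adicCompletion ℚ) τ)).val * X₀ -
                X₀ * (σ' (absGaloisRestrict ℚ (v.adicCompletion ℚ) τ)).val)) *ᵥ y₁ = 0) ∧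
        (∃ (X₀ : Matrix (Fin 2) (Fin 2) k) (x₁ y₁ : Fin 2 → k), x₁ ≠ 0 ∧ y₁ ≠ 0 ∧
          (∀ τ ∈ absInertia (v.adicCompletion ℚ),
            (σ (absGaloisRestrict ℚ (v.adicCompletion ℚ) τ)).val *ᵥ x₁ = x₁) ∧
          (∀ τ ∈ absInertia (v.adicCompletion ℚ),
            (σ' (absGaloisRestrict ℚ (v.adicCompletion ℚ) τ)).val *ᵥ y₁ = y₁) ∧
          ∀ τ ∈ absInertia (v.adicCompletion ℚ),
            (B₂ (absGaloisRestrict ℚ (v.adicCompletion ℚ) τ) -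
              ((σ (absGaloisRestrict ℚ (v.adicCompletion ℚ) τ)).val * X₀ -
                X₀ * (σ' (absGaloisRestrict ℚ (v.adicCompletion ℚ) τ)).val)) *ᵥ y₁ = 0)) →
      (¬ ∃ X : Matrix (Fin 2) (Fin 2) k, ∀ g, B₁ g = (σ g).val * X - X * (σ' g).val) →
      (¬ ∃ X : Matrix (Fin 2) (Fin 2) k, ∀ g, B₂ g = (σ g).val * X - X * (σ' g).val) →
      ∃ (c : kˣ) (X : Matrix (Fin 2) (Fin 2) k), ∀ g, B₂ g = (c : k) • B₁ g + ((σ g).val * X - X * (σ' g).val)) →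
    ∃ ρ₁ : FramedGaloisRep ℚ (PadicAlgCl p) 4, ρ₁.toGaloisRep.IsIrreducible ∧ Aut p hcpt ι ρ₁ ∧
      (∃ c : ℕ, (c : ZMod (p - 1)) = 1 ∧
        (∃ ν : Field.absoluteGaloisGroup ℚ → PadicAlgCl p, ρ₁.IsSymplecticWithMultiplierFun ν) ∧
        ∀ v : HeightOneSpectrum (NumberField.RingOfIntegers ℚ), ((p : ℕ) : NumberField.RingOfIntegers ℚ) ∈ v.asIdeal →
          ρ₁.IsGreenbergOrdinaryOfShapeAt v ![0, 0, c, c] ∧ ρ₁.IsResiduallyDistinguishedAt v ![0, 0, c, c]) ∧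
      ∃ (P : GL (Fin 4) (PadicAlgCl p))
        (rint : Field.absoluteGaloisGroup ℚ →* GL (Fin 4) (Valued.integer (PadicAlgCl p))) (h : GL (Fin 4) k),
        (∀ g, Matrix.GeneralLinearGroup.map (Valued.integer (PadicAlgCl p)).subtype (rint g) = P⁻¹ * ρ₁ g * P) ∧
        (∀ g, (Matrix.GeneralLinearGroup.map red (rint g)).val =
          h.val * Matrix.reindex finSumFinEquiv finSumFinEquiv
            (Matrix.fromBlocks (σ g).val (B g) 0 (σ' g).val) * (h⁻¹).val) := by
  intro p _ hp k _ _ _ _ _ red σ σ' hcpt ι ρ₀ ρ B S hσ hσ' hdet hnc hρ₀ hSh₀ hA₀ hB hSh hreal hS hrank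
  obtain ⟨P, rint, h, hP, hred⟩ := hreal
  -- Ribet (R1a) for the anchor: a non-trivial class `B₀` realised by `ρ₀`
  obtain ⟨P₀, rint₀, h₀, B₀, hP₀, hred₀, hB₀⟩ :=
    Ribet.stub_ribetNonsplitLattice p k red σ σ' ρ₀ hσ hσ' hnc hρ₀ hSh₀.2.2
  -- both realised classes are Greenberg–Selmer cocycles (K3)
  obtain ⟨hcoc₀, hlc₀, hur₀, hgr₀⟩ := Fibre.stub_realisedClassSelmer p hp k red σ σ' ρ₀ P₀ rint₀ h₀ B₀ hdet hSh₀ hP₀ hred₀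
  obtain ⟨hcoc, hlc, hur, hgr⟩ := Fibre.stub_realisedClassSelmer p hp k red σ σ' ρ P rint h B hdet hSh hP hred
  -- rank one: `B` is projectively equal to `B₀` modulo coboundaries
  obtain ⟨c, X, hcX⟩ := hrank B₀ B hcoc₀ hcoc hlc₀ hlc
    (fun v hv 𝔓 h𝔓 i hi => ⟨hur₀ v (hS v hv).2 𝔓 h𝔓 i hi, hur v (hS v hv).1 𝔓 h𝔓 i hi⟩)
    (fun v hv => ⟨hgr₀ v hv, hgr v hv⟩) hB₀ hB
  -- the anchor realises every class projectively equal to its own (p148691)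
  exact stub_anchorOfSameClass p hp k red σ σ' hcpt ι ρ₀ B₀ B hρ₀ hSh₀ hA₀ ⟨P₀, rint₀, h₀, hP₀, hred₀⟩ ⟨c, X, hcX⟩

end Summit.Langlands.Langlands.Cruxes.ResiduallyYoshidaLifting.SectorKlingenSplit.Fibre

end
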